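import Summits.KontsevichZagierPeriods.KontsevichZagierPeriods.Theorems.LinRedNormalFormWheelThreeSpokesCharts

/-!
# `WheelThreeSpokes` (stmt-KontsevichZagierPeriods-3913), line `laplacian-ldl-chart`: the LDLᵀ chart

Stub `stub_ldlChart` of the lead's skeleton: ONE change of variables (Kontsevich–Zagier rule (2))
along the POLYNOMIAL chart of the `LDLᵀ` (Cholesky/Iwasawa) factorisation of the reduced `K₄`
Laplacian `Y = L·D·Lᵀ`, `D = diag(1, d₂, d₃)`, `u = −l₂₁`, `v = −l₃₁`, `w = −l₃₂`, in coordinates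
`y = (u, v, w, d₂, d₃)`:

`chart(y) = (u, v, w d₂ − u v, d₂(1 − w) − u(1 − u − v), d₃ − C)`, `C = v(1 − u − v) + w(1 − w)d₂`,

from `D5 = {0 < u, 0 < v, u + v < 1, uv < w d₂, u(1−u−v) < d₂(1−w), C < d₃}` onto
`Z5 = {0 < z₀, 0 < z₁, z₀ + z₁ < 1, 0 < z₂, 0 < z₃, 0 < z₄}`. Its Jacobian determinant is the
polynomial `d₂` (the first two rows of the Jacobian matrix are unit vectors), the determinant of the
Laplacian is a monomial in the chart, `Ψᴰ(chart(y)) = d₂ d₃`, so the integrand `1/Ψᴰ(z)²` pulls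
back to `1/(d₂d₃)² · |d₂| = 1/(d₂ d₃²)`; the chart is injective on `D5` with inverse
`d₂ = z₂ + z₃ + z₀(1 − z₀)`, `w = (z₂ + z₀z₁)/d₂`, `d₃ = z₄ + C`. Everything else (semialgebraic
side conditions, transport of absolute integrability in both directions, the move itself) is
`BeukersZeta3.polyChart_transport`.

References: M. Kontsevich, D. Zagier, *Periods* (2001), §1.2 rule (2); J. Bochnak, M. Coste,
M.-F. Roy, *Real Algebraic Geometry* (1998), §2.1–2.2.
-/

noncomputable section

open Set MeasureTheory MvPolynomial
open Literature.NumberTheory.Transcendental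
open Literature.ModelTheory.ExponentialFields (IsSemialgebraic isSemialgebraic_setOf_eval_lt)

namespace Summit.KontsevichZagierPeriods.LinRedNormalForm.WheelThreeSpokes

namespace LdlChart

/-! ## Semialgebraic domain -/

/-- A conjunction of six strict polynomial inequalities cuts out a `ℚ`-semialgebraic subset of
`ℝⁿ`. [cite: BochnakCosteRoy1998, Def. 2.1.4] -/
theorem isSemialgebraic_setOf_six_lt_fin {n : ℕ}
    (p₁ q₁ p₂ q₂ p₃ q₃ p₄ q₄ p₅ q₅ p₆ q₆ : MvPolynomial (Fin n) ℚ) :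
    IsSemialgebraic ℚ {x : Fin n → ℝ | aeval x p₁ < aeval x q₁ ∧ aeval x p₂ < aeval x q₂ ∧
      aeval x p₃ < aeval x q₃ ∧ aeval x p₄ < aeval x q₄ ∧ aeval x p₅ < aeval x q₅ ∧
      aeval x p₆ < aeval x q₆} := by
  have h := (((isSemialgebraic_setOf_eval_lt (R := ℝ) p₁ q₁).inter
    (isSemialgebraic_setOf_eval_lt p₂ q₂)).inter ((isSemialgebraic_setOf_eval_lt p₃ q₃).inter
    (isSemialgebraic_setOf_eval_lt p₄ q₄))).inter ((isSemialgebraic_setOf_eval_lt p₅ q₅).inter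
    (isSemialgebraic_setOf_eval_lt p₆ q₆))
  have hset : {x : Fin n → ℝ | aeval x p₁ < aeval x q₁ ∧ aeval x p₂ < aeval x q₂ ∧
      aeval x p₃ < aeval x q₃ ∧ aeval x p₄ < aeval x q₄ ∧ aeval x p₅ < aeval x q₅ ∧
      aeval x p₆ < aeval x q₆} = ({x : Fin n → ℝ | aeval x p₁ < aeval x q₁} ∩
      {x | aeval x p₂ < aeval x q₂} ∩ ({x | aeval x p₃ < aeval x q₃} ∩
      {x | aeval x p₄ < aeval x q₄})) ∩
      ({x | aeval x p₅ < aeval x q₅} ∩ {x | aeval x p₆ < aeval x q₆}) := by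
    ext x
    simp only [mem_setOf_eq, mem_inter_iff, and_assoc]
  rw [hset]
  exact h

/-- `D5 = {0 < u, 0 < v, u + v < 1, uv < w d₂, u(1−u−v) < d₂(1−w), C < d₃}` is `ℚ`-semialgebraic.
[folklore] -/
theorem isSemialgebraic_D5 :
    IsSemialgebraic ℚ {y : Fin 5 → ℝ | 0 < y 0 ∧ 0 < y 1 ∧ y 0 + y 1 < 1 ∧
      y 0 * y 1 < y 2 * y 3 ∧ y 0 * (1 - y 0 - y 1) < y 3 * (1 - y 2) ∧
      y 1 * (1 - y 0 - y 1) + y 2 * (1 - y 2) * y 3 < y 4} := by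
  have h := isSemialgebraic_setOf_six_lt_fin (n := 5) 0 (X 0) 0 (X 1) (X 0 + X 1) 1
    (X 0 * X 1) (X 2 * X 3) (X 0 * (1 - X 0 - X 1)) (X 3 * (1 - X 2))
    (X 1 * (1 - X 0 - X 1) + X 2 * (1 - X 2) * X 3) (X 4)
  simp only [map_zero, map_one, map_mul, map_sub, map_add, aeval_X] at h
  exact h

/-- On `D5` the pivot `d₂ = y₃` is positive (`0 < uv < w d₂` and `0 < u(1−u−v) < d₂(1−w)` give
`d₂ = w d₂ + d₂(1−w) > 0`). [folklore] -/
theorem ldl_pivot_pos {y : Fin 5 → ℝ} (h1 : 0 < y 0) (h2 : 0 < y 1) (h3 : y 0 + y 1 < 1)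
    (h4 : y 0 * y 1 < y 2 * y 3) (h5 : y 0 * (1 - y 0 - y 1) < y 3 * (1 - y 2)) : 0 < y 3 := by
  have ha : 0 < y 2 * y 3 := lt_trans (mul_pos h1 h2) h4
  have hb : 0 < y 3 * (1 - y 2) := lt_trans (mul_pos h1 (by linarith)) h5
  nlinarith

/-! ## The chart: values, Jacobian, injectivity, image, pull-back -/

/-- Values of the LDLᵀ chart `(u,v,w,d₂,d₃) ↦ (u, v, w d₂ − u v, d₂(1−w) − u(1−u−v), d₃ − C)`.
[folklore] -/
theorem ldlChart_apply (y : Fin 5 → ℝ) :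
    (fun i => aeval y ((![X 0, X 1, X 2 * X 3 - X 0 * X 1,
      X 3 * (1 - X 2) - X 0 * (1 - X 0 - X 1),
      X 4 - (X 1 * (1 - X 0 - X 1) + X 2 * (1 - X 2) * X 3)] : Fin 5 → MvPolynomial (Fin 5) ℚ) i)) =
      ![y 0, y 1, y 2 * y 3 - y 0 * y 1, y 3 * (1 - y 2) - y 0 * (1 - y 0 - y 1),
      y 4 - (y 1 * (1 - y 0 - y 1) + y 2 * (1 - y 2) * y 3)] := by
  funext i; fin_cases i <;> simp

/-- Jacobian determinant of the LDLᵀ chart: `d₂ = y₃` (expand along the two unit rows, then a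
`3 × 3` determinant). [folklore] -/
theorem det_ldlChart (y : Fin 5 → ℝ) :
    (Matrix.of fun i j => aeval y (pderiv j ((![X 0, X 1, X 2 * X 3 - X 0 * X 1,
      X 3 * (1 - X 2) - X 0 * (1 - X 0 - X 1),
      X 4 - (X 1 * (1 - X 0 - X 1) + X 2 * (1 - X 2) * X 3)] : Fin 5 → MvPolynomial (Fin 5) ℚ) i)) :
      Matrix (Fin 5) (Fin 5) ℝ).det = aeval y (X 3 : MvPolynomial (Fin 5) ℚ) := by
  rw [Matrix.det_succ_row_zero, Fin.sum_univ_succ]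
  simp [Fin.sum_univ_succ, Matrix.det_succ_row_zero, Fin.succAbove]
  ring

/-- The LDLᵀ chart is injective on `D5`: `u, v` are read off, `d₂ = z₂ + z₃ + u(1−u)`,
`w d₂ = z₂ + uv` with `d₂ > 0`, `d₃ = z₄ + C`. [folklore] -/
theorem injOn_ldlChart :
    InjOn (fun (x : Fin 5 → ℝ) (i : Fin 5) => aeval x ((![X 0, X 1, X 2 * X 3 - X 0 * X 1,
      X 3 * (1 - X 2) - X 0 * (1 - X 0 - X 1),
      X 4 - (X 1 * (1 - X 0 - X 1) + X 2 * (1 - X 2) * X 3)] : Fin 5 → MvPolynomial (Fin 5) ℚ) i))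
    {y : Fin 5 → ℝ | 0 < y 0 ∧ 0 < y 1 ∧ y 0 + y 1 < 1 ∧
      y 0 * y 1 < y 2 * y 3 ∧ y 0 * (1 - y 0 - y 1) < y 3 * (1 - y 2) ∧
      y 1 * (1 - y 0 - y 1) + y 2 * (1 - y 2) * y 3 < y 4} := by
  rintro x ⟨h1, h2, h3, h4, h5, -⟩ x' - h
  have hx3 : 0 < x 3 := ldl_pivot_pos h1 h2 h3 h4 h5
  have h' := h
  beta_reduce at h'
  rw [ldlChart_apply, ldlChart_apply] at h'
  simp only [Matrix.vecCons_inj] at h'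
  obtain ⟨e0, e1, e2, e3, e4, -⟩ := h'
  rw [← e0, ← e1] at e2 e3 e4
  have e3' : x 3 = x' 3 := by nlinarith
  have e2' : x 2 = x' 2 := by
    have h23 : x 2 * x 3 = x' 2 * x' 3 := by linarith
    rw [← e3'] at h23
    exact mul_right_cancel₀ hx3.ne' h23
  have e4' : x 4 = x' 4 := by
    rw [← e2', ← e3'] at e4
    linarith
  funext i
  fin_cases i
  · exact e0
  · exact e1
  · exact e2'
  · exact e3'
  · exact e4'

/-- The LDLᵀ chart maps `D5` onto `Z5 = {0 < z₀, 0 < z₁, z₀ + z₁ < 1, 0 < z₂, 0 < z₃, 0 < z₄}`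
(the last three inequalities of `D5` are literally `z₂, z₃, z₄ > 0`; inverse
`d₂ = z₂ + z₃ + z₀(1−z₀)`, `w = (z₂ + z₀z₁)/d₂`, `d₃ = z₄ + C`). [folklore] -/
theorem image_ldlChart :
    (fun (x : Fin 5 → ℝ) (i : Fin 5) => aeval x ((![X 0, X 1, X 2 * X 3 - X 0 * X 1,
      X 3 * (1 - X 2) - X 0 * (1 - X 0 - X 1),
      X 4 - (X 1 * (1 - X 0 - X 1) + X 2 * (1 - X 2) * X 3)] : Fin 5 → MvPolynomial (Fin 5) ℚ) i))
    '' {y : Fin 5 → ℝ | 0 < y 0 ∧ 0 < y 1 ∧ y 0 + y 1 < 1 ∧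
      y 0 * y 1 < y 2 * y 3 ∧ y 0 * (1 - y 0 - y 1) < y 3 * (1 - y 2) ∧
      y 1 * (1 - y 0 - y 1) + y 2 * (1 - y 2) * y 3 < y 4} =
    {z : Fin 5 → ℝ | 0 < z 0 ∧ 0 < z 1 ∧ z 0 + z 1 < 1 ∧
      0 < z 2 ∧ 0 < z 3 ∧ 0 < z 4} := by
  ext z
  constructor
  · rintro ⟨y, ⟨h1, h2, h3, h4, h5, h6⟩, rfl⟩
    simp only [mem_setOf_eq, ldlChart_apply, Matrix.cons_val_zero, Matrix.cons_val_one,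
      Matrix.cons_val]
    exact ⟨h1, h2, h3, sub_pos.mpr h4, sub_pos.mpr h5, sub_pos.mpr h6⟩
  · rintro ⟨h1, h2, h3, h4, h5, h6⟩
    -- the inverse chart
    obtain ⟨d₂, hd₂⟩ : ∃ d₂ : ℝ, d₂ = z 2 + z 3 + z 0 * (1 - z 0) := ⟨_, rfl⟩
    have hd₂pos : 0 < d₂ := by
      have := mul_pos h1 (by linarith : (0 : ℝ) < 1 - z 0)
      rw [hd₂]
      linarith
    obtain ⟨w, hw⟩ : ∃ w : ℝ, w = (z 2 + z 0 * z 1) / d₂ := ⟨_, rfl⟩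
    obtain ⟨d₃, hd₃⟩ : ∃ d₃ : ℝ, d₃ = z 4 + (z 1 * (1 - z 0 - z 1) + w * (1 - w) * d₂) :=
      ⟨_, rfl⟩
    have hwd : w * d₂ = z 2 + z 0 * z 1 := by
      rw [hw]
      field_simp
    have hc2 : w * d₂ - z 0 * z 1 = z 2 := by
      rw [hwd]
      ring
    have hdw : d₂ * (1 - w) = z 3 + z 0 * (1 - z 0 - z 1) := by
      have : d₂ * (1 - w) = d₂ - w * d₂ := by ring
      rw [this, hwd, hd₂]
      ring
    have hc3 : d₂ * (1 - w) - z 0 * (1 - z 0 - z 1) = z 3 := by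
      rw [hdw]
      ring
    have hc4 : d₃ - (z 1 * (1 - z 0 - z 1) + w * (1 - w) * d₂) = z 4 := by
      rw [hd₃]
      ring
    refine ⟨![z 0, z 1, w, d₂, d₃], ?_, ?_⟩
    · simp only [mem_setOf_eq, Matrix.cons_val_zero, Matrix.cons_val_one, Matrix.cons_val]
      refine ⟨h1, h2, h3, ?_, ?_, ?_⟩
      · rw [hwd]
        linarith
      · rw [hdw]
        linarith
      · rw [hd₃]
        linarith
    · beta_reduce
      rw [ldlChart_apply]
      simp only [Matrix.cons_val_zero, Matrix.cons_val_one, Matrix.cons_val]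
      rw [hc2, hc3, hc4]
      funext i
      fin_cases i <;> rfl

/-- Pull-back identity for the LDLᵀ chart: `Ψᴰ(chart(y)) = d₂ d₃`, so
`1/(d₂ d₃²) = 1/Ψᴰ(chart(y))² · |d₂|` on `D5`. [folklore] -/
theorem hgh_ldlChart : ∀ y ∈ {y : Fin 5 → ℝ | 0 < y 0 ∧ 0 < y 1 ∧ y 0 + y 1 < 1 ∧
      y 0 * y 1 < y 2 * y 3 ∧ y 0 * (1 - y 0 - y 1) < y 3 * (1 - y 2) ∧
      y 1 * (1 - y 0 - y 1) + y 2 * (1 - y 2) * y 3 < y 4},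
    (1 / (y 3 * y 4 ^ 2) : ℝ) =
    (fun z : Fin 5 → ℝ => 1 / ((z 0 + z 2 + z 3) * (z 1 + z 2 + z 4) - z 2 ^ 2 -
      z 0 ^ 2 * (z 1 + z 2 + z 4) - 2 * z 0 * z 1 * z 2 - z 1 ^ 2 * (z 0 + z 2 + z 3)) ^ 2)
      (fun i => aeval y ((![X 0, X 1, X 2 * X 3 - X 0 * X 1,
      X 3 * (1 - X 2) - X 0 * (1 - X 0 - X 1),
      X 4 - (X 1 * (1 - X 0 - X 1) + X 2 * (1 - X 2) * X 3)] : Fin 5 → MvPolynomial (Fin 5) ℚ) i)) *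
      |aeval y (X 3 : MvPolynomial (Fin 5) ℚ)| := by
  rintro y ⟨h1, h2, h3, h4, h5, h6⟩
  have hy3 : 0 < y 3 := ldl_pivot_pos h1 h2 h3 h4 h5
  have hy2 : 0 < y 2 := (pos_iff_pos_of_mul_pos (lt_trans (mul_pos h1 h2) h4)).mpr hy3
  have hy2' : 0 < 1 - y 2 :=
    (pos_iff_pos_of_mul_pos (lt_trans (mul_pos h1 (by linarith)) h5)).mp hy3
  have hy4 : 0 < y 4 := by
    have hC1 : 0 < y 1 * (1 - y 0 - y 1) := mul_pos h2 (by linarith)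
    have hC2 : 0 < y 2 * (1 - y 2) * y 3 := mul_pos (mul_pos hy2 hy2') hy3
    linarith
  rw [ldlChart_apply]
  simp only [Matrix.cons_val_zero, Matrix.cons_val_one, Matrix.cons_val, aeval_X]
  rw [abs_of_pos hy3]
  have hΨ : (y 0 + (y 2 * y 3 - y 0 * y 1) + (y 3 * (1 - y 2) - y 0 * (1 - y 0 - y 1))) *
      (y 1 + (y 2 * y 3 - y 0 * y 1) + (y 4 - (y 1 * (1 - y 0 - y 1) + y 2 * (1 - y 2) * y 3))) -
      (y 2 * y 3 - y 0 * y 1) ^ 2 -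
      y 0 ^ 2 * (y 1 + (y 2 * y 3 - y 0 * y 1) + (y 4 - (y 1 * (1 - y 0 - y 1) +
        y 2 * (1 - y 2) * y 3))) -
      2 * y 0 * y 1 * (y 2 * y 3 - y 0 * y 1) -
      y 1 ^ 2 * (y 0 + (y 2 * y 3 - y 0 * y 1) + (y 3 * (1 - y 2) - y 0 * (1 - y 0 - y 1))) =
      y 3 * y 4 := by
    ring
  rw [hΨ]
  field_simp

end LdlChart

/-! ## The stub -/

/-- **stub_ldlChart**. The LDLᵀ chart of the reduced `K₄` Laplacian (rule 2, POLYNOMIAL chart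
`(u,v,w,d₂,d₃) ↦ (u, v, w d₂ − u v, d₂(1−w) − u(1−u−v), d₃ − v(1−u−v) − w(1−w)d₂)` from `D5` onto
`Z5`, Jacobian `d₂`, `Ψᴰ ∘ chart = d₂ d₃`): (i) from any representation `[Z5, ≡ 1/Ψᴰ²]` the
representation `[D5, 1/(d₂d₃²)]` exists (absolute integrability transported along the chart);
(ii) any two representations of these two shapes are Kontsevich–Zagier equivalent (one move).
[cite: KontsevichZagier2001, §1.2 rule (2)] -/
theorem stub_ldlChart :
    (∀ s : KZ.IntegralRep 5, s.domain = {z : Fin 5 → ℝ | 0 < z 0 ∧ 0 < z 1 ∧ z 0 + z 1 < 1 ∧ 0 < z 2 ∧ 0 < z 3 ∧ 0 < z 4} →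
      Set.EqOn s.integrand (fun z => 1 / ((z 0 + z 2 + z 3) * (z 1 + z 2 + z 4) - z 2 ^ 2 - z 0 ^ 2 * (z 1 + z 2 + z 4) - 2 * z 0 * z 1 * z 2 - z 1 ^ 2 * (z 0 + z 2 + z 3)) ^ 2) s.domain →
      ∃ d : KZ.IntegralRep 5, d.domain = {y : Fin 5 → ℝ | 0 < y 0 ∧ 0 < y 1 ∧ y 0 + y 1 < 1 ∧ y 0 * y 1 < y 2 * y 3 ∧ y 0 * (1 - y 0 - y 1) < y 3 * (1 - y 2) ∧ y 1 * (1 - y 0 - y 1) + y 2 * (1 - y 2) * y 3 < y 4} ∧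
        d.integrand = fun y => 1 / (y 3 * y 4 ^ 2)) ∧
    (∀ d s : KZ.IntegralRep 5, d.domain = {y : Fin 5 → ℝ | 0 < y 0 ∧ 0 < y 1 ∧ y 0 + y 1 < 1 ∧ y 0 * y 1 < y 2 * y 3 ∧ y 0 * (1 - y 0 - y 1) < y 3 * (1 - y 2) ∧ y 1 * (1 - y 0 - y 1) + y 2 * (1 - y 2) * y 3 < y 4} →
      Set.EqOn d.integrand (fun y => 1 / (y 3 * y 4 ^ 2)) d.domain →
      s.domain = {z : Fin 5 → ℝ | 0 < z 0 ∧ 0 < z 1 ∧ z 0 + z 1 < 1 ∧ 0 < z 2 ∧ 0 < z 3 ∧ 0 < z 4} →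
      Set.EqOn s.integrand (fun z => 1 / ((z 0 + z 2 + z 3) * (z 1 + z 2 + z 4) - z 2 ^ 2 - z 0 ^ 2 * (z 1 + z 2 + z 4) - 2 * z 0 * z 1 * z 2 - z 1 ^ 2 * (z 0 + z 2 + z 3)) ^ 2) s.domain →
      KZ.Equivalent d s) := by
  have hT := BeukersZeta3.polyChart_transport (![X 0, X 1, X 2 * X 3 - X 0 * X 1,
      X 3 * (1 - X 2) - X 0 * (1 - X 0 - X 1),
      X 4 - (X 1 * (1 - X 0 - X 1) + X 2 * (1 - X 2) * X 3)] : Fin 5 → MvPolynomial (Fin 5) ℚ) (X 3)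
    LdlChart.isSemialgebraic_D5 (fun y _ => LdlChart.det_ldlChart y) LdlChart.injOn_ldlChart
    (fun y => 1 / (y 3 * y 4 ^ 2))
    (fun z : Fin 5 → ℝ => 1 / ((z 0 + z 2 + z 3) * (z 1 + z 2 + z 4) - z 2 ^ 2 -
      z 0 ^ 2 * (z 1 + z 2 + z 4) - 2 * z 0 * z 1 * z 2 - z 1 ^ 2 * (z 0 + z 2 + z 3)) ^ 2)
    LdlChart.hgh_ldlChart
  rw [LdlChart.image_ldlChart] at hT
  exact ⟨hT.1, fun d s hdd hdi hsd hsi => hT.2.2 d s hdd (hdd ▸ hdi) hsd hsi⟩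

end Summit.KontsevichZagierPeriods.LinRedNormalForm.WheelThreeSpokes
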